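import Summits.MatrixMultiplication.MatrixMultiplication.Theorems.AbelianSTPPCensusTB4StatDefs

/-!
# T_B static certificate, range `5591 … 5994` (t*-indexed linear checker with the k-member tree at `τ = 2375/1000`): kernel evaluation, the completeness of the bucket lists, volumes `1001 … (chunk starting 1451)` (small volume chunks: the kernel recursion through the long low-`t` lists is bounded per theorem)

Cell mm-stpp (rung F-M1), tier T_B = «beat `2.375` (Coppersmith–Winograd)»; checker in `AbelianSTPPCensusTB4StatDefs.lean`, table and bucket lists in `AbelianSTPPCensusTB4StatData.lean`
(pattern: theory g12's `AbelianSTPPCensusTAStatDDom*/DCk*.lean`).  `decide` with kernel reduction (standard axioms; no `native_decide`), `Elab.async false`;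
consumed by `TB4Stat.checkV_sound` / `TB4Stat.domV_sound` / `TB4Stat.m2V_sound` in the leaf `AbelianSTPPCensusLeafTB5994Closed.lean`.
WHAT THIS IS NOT: arithmetic on shape lists only; no statement about STPP families or `ω`.
-/

set_option linter.dupNamespace false
set_option autoImplicit false
set_option Elab.async false

namespace Summit.MatrixMultiplication.MatrixMultiplication.Theorems.TB4Stat

set_option maxHeartbeats 0 in
/-- Completeness chunk: every sorted candidate shape of the volumes `1001 … 1050` lies in the list of the bucket of its `a·b` (355 shapes). [original] -/
theorem m2c1001 : TB4Stat.m2V 50 1001 = true := by decide +kernel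

set_option maxHeartbeats 0 in
/-- Completeness chunk: every sorted candidate shape of the volumes `1051 … 1100` lies in the list of the bucket of its `a·b` (356 shapes). [original] -/
theorem m2c1051 : TB4Stat.m2V 50 1051 = true := by decide +kernel

set_option maxHeartbeats 0 in
/-- Completeness chunk: every sorted candidate shape of the volumes `1101 … 1150` lies in the list of the bucket of its `a·b` (341 shapes). [original] -/
theorem m2c1101 : TB4Stat.m2V 50 1101 = true := by decide +kernel

set_option maxHeartbeats 0 in
/-- Completeness chunk: every sorted candidate shape of the volumes `1151 … 1200` lies in the list of the bucket of its `a·b` (396 shapes). [original] -/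
theorem m2c1151 : TB4Stat.m2V 50 1151 = true := by decide +kernel

set_option maxHeartbeats 0 in
/-- Completeness chunk: every sorted candidate shape of the volumes `1201 … 1250` lies in the list of the bucket of its `a·b` (343 shapes). [original] -/
theorem m2c1201 : TB4Stat.m2V 50 1201 = true := by decide +kernel

set_option maxHeartbeats 0 in
/-- Completeness chunk: every sorted candidate shape of the volumes `1251 … 1300` lies in the list of the bucket of its `a·b` (378 shapes). [original] -/
theorem m2c1251 : TB4Stat.m2V 50 1251 = true := by decide +kernel

set_option maxHeartbeats 0 in
/-- Completeness chunk: every sorted candidate shape of the volumes `1301 … 1350` lies in the list of the bucket of its `a·b` (369 shapes). [original] -/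
theorem m2c1301 : TB4Stat.m2V 50 1301 = true := by decide +kernel

set_option maxHeartbeats 0 in
/-- Completeness chunk: every sorted candidate shape of the volumes `1351 … 1400` lies in the list of the bucket of its `a·b` (365 shapes). [original] -/
theorem m2c1351 : TB4Stat.m2V 50 1351 = true := by decide +kernel

set_option maxHeartbeats 0 in
/-- Completeness chunk: every sorted candidate shape of the volumes `1401 … 1450` lies in the list of the bucket of its `a·b` (374 shapes). [original] -/
theorem m2c1401 : TB4Stat.m2V 50 1401 = true := by decide +kernel

set_option maxHeartbeats 0 in
/-- Completeness chunk: every sorted candidate shape of the volumes `1451 … 1500` lies in the list of the bucket of its `a·b` (381 shapes). [original] -/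
theorem m2c1451 : TB4Stat.m2V 50 1451 = true := by decide +kernel

end Summit.MatrixMultiplication.MatrixMultiplication.Theorems.TB4Stat
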